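import Summits.Ventures.HodgeRepro.Night4ReducedDimEight

/-!
# Degree 10 — the census degree the route's table skips: every face of the cyclic decic CM field has `dim B_red ∈ {10, 11, 15}`

Blind re-derivation cell `pub-hodge-repro`, seat `night-4` (ROUTE HARDENING for the Monday FINAL, gen 4).  Target tree
path `lean/Summits/Ventures/HodgeRepro/Night4ReducedDimTen.lean`.

ROUTE.md v2.89 §3 tabulates the rank-four faces of the Galois CM fields of degree 6, 8 and 12 (the sealed Tier-2 census)
and says in §3.5 (i): «The smallest objects on which S4 — hence S0 beyond the known regime — are open are: the sixfolds
A × E × E′ (C2³, C4 × C2) and A × S (C4 × C2) …; the eightfolds A₁ × A₂ (C8, Q8); the ninefolds … — [v2.21] for the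
CENSUS degrees 6, 8, 12».  Degree 10 is not in the census.  A Galois CM field of degree 10 has Galois group `C10`
(the dihedral group `D5` has no central involution, so it is not the Galois group of a CM field — `complexConjs_D5`
below), with the unique involution `5`.  This file puts the degree-10 count on the kernel with the method of parts
I / II (`redDim_faceCorners_of_reps`, place representatives; five `decide +kernel`s of 32 types × 4 pairs each):

* `redDim_faceCorners_C10 : IsCMType cc_C10 Φ → p′ ∉ place cc_C10 p → redDim (faceCorners cc_C10 Φ p p′) = 10 ∨
  = 11 ∨ = 15` — every value attained (`A₅ × A₅′`, `A₅ × A₅′ × E`, `A₅ × A₅′ × A₅″`: the corners are simple CM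
  fivefolds, `simpleDim = 5`, except the two lifts from the imaginary quadratic subfield, `simpleDim = 1`);
* hence `10 ≤ dim B_red` on every degree-10 face: the degree-8 sixfolds, sevenfold and eightfolds remain the smallest
  open objects when degree 10 is added to the table (`ten_le_redDim_faceCorners_C10`).

The names `C10` / `cc_C10` are declared here (the typer's `Groups.lean` stops at the census degrees; prefixed `night4`
to avoid the dedup lint).  Nothing here says anything about the status of the Hodge conjecture for CM abelian
varieties, which is NOT proved.
-/

set_option autoImplicit false

open Finset

namespace HodgeRepro

/-! ## The cyclic group of order 10 and its involution -/

/-- The cyclic group of order 10, `Gal(F/ℚ)` of a cyclic decic CM field. -/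
abbrev night4C10 := Multiplicative (ZMod 10)

/-- Its unique involution `5`, the complex conjugation. -/
def cc_night4C10 : night4C10 := Multiplicative.ofAdd 5

/-- `5` is a complex conjugation. -/
theorem cc_night4C10_isComplexConj : IsComplexConj cc_night4C10 := by decide

/-- `5` is the only complex conjugation of `C10`. -/
theorem complexConjs_night4C10 : complexConjs night4C10 = {cc_night4C10} := by decide

/-- `D5` has no central involution: no CM field has Galois group `D5`. -/
theorem complexConjs_D5 : complexConjs (DihedralGroup 5) = ∅ := by decide

/-- `card C10 = 10`. -/
theorem card_night4C10 : Fintype.card night4C10 = 10 := by decide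

/-- There are `2⁵ = 32` CM types. -/
theorem card_cmTypes_night4C10 : (cmTypes cc_night4C10).card = 32 := by decide

/-! ## The count on place representatives, one representative at a time -/

/-- Representatives of the five places of `(C10, 5)`. -/
def night4Reps_C10 : List night4C10 :=
  [Multiplicative.ofAdd 0, Multiplicative.ofAdd 1, Multiplicative.ofAdd 2, Multiplicative.ofAdd 3,
    Multiplicative.ofAdd 4]

/-- `night4Reps_C10` meets every place. -/
theorem night4Reps_C10_cover : ∀ p : night4C10, ∃ r ∈ night4Reps_C10, r = p ∨ cc_night4C10 * r = p := by decide

/-- The value set, first place `0` (KERNEL: 32 types × 4 second places). -/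
theorem redDim_faceCorners_C10_reps0 : ∀ Φ ∈ cmTypes cc_night4C10, ∀ p' ∈ night4Reps_C10,
    p' ∉ place cc_night4C10 (Multiplicative.ofAdd 0) →
      redDim (faceCorners cc_night4C10 Φ (Multiplicative.ofAdd 0) p') = 10 ∨
      redDim (faceCorners cc_night4C10 Φ (Multiplicative.ofAdd 0) p') = 11 ∨
      redDim (faceCorners cc_night4C10 Φ (Multiplicative.ofAdd 0) p') = 15 := by
  decide +kernel

/-- The value set, first place `1` (KERNEL). -/
theorem redDim_faceCorners_C10_reps1 : ∀ Φ ∈ cmTypes cc_night4C10, ∀ p' ∈ night4Reps_C10,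
    p' ∉ place cc_night4C10 (Multiplicative.ofAdd 1) →
      redDim (faceCorners cc_night4C10 Φ (Multiplicative.ofAdd 1) p') = 10 ∨
      redDim (faceCorners cc_night4C10 Φ (Multiplicative.ofAdd 1) p') = 11 ∨
      redDim (faceCorners cc_night4C10 Φ (Multiplicative.ofAdd 1) p') = 15 := by
  decide +kernel

/-- The value set, first place `2` (KERNEL). -/
theorem redDim_faceCorners_C10_reps2 : ∀ Φ ∈ cmTypes cc_night4C10, ∀ p' ∈ night4Reps_C10,
    p' ∉ place cc_night4C10 (Multiplicative.ofAdd 2) →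
      redDim (faceCorners cc_night4C10 Φ (Multiplicative.ofAdd 2) p') = 10 ∨
      redDim (faceCorners cc_night4C10 Φ (Multiplicative.ofAdd 2) p') = 11 ∨
      redDim (faceCorners cc_night4C10 Φ (Multiplicative.ofAdd 2) p') = 15 := by
  decide +kernel

/-- The value set, first place `3` (KERNEL). -/
theorem redDim_faceCorners_C10_reps3 : ∀ Φ ∈ cmTypes cc_night4C10, ∀ p' ∈ night4Reps_C10,
    p' ∉ place cc_night4C10 (Multiplicative.ofAdd 3) →
      redDim (faceCorners cc_night4C10 Φ (Multiplicative.ofAdd 3) p') = 10 ∨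
      redDim (faceCorners cc_night4C10 Φ (Multiplicative.ofAdd 3) p') = 11 ∨
      redDim (faceCorners cc_night4C10 Φ (Multiplicative.ofAdd 3) p') = 15 := by
  decide +kernel

/-- The value set, first place `4` (KERNEL). -/
theorem redDim_faceCorners_C10_reps4 : ∀ Φ ∈ cmTypes cc_night4C10, ∀ p' ∈ night4Reps_C10,
    p' ∉ place cc_night4C10 (Multiplicative.ofAdd 4) →
      redDim (faceCorners cc_night4C10 Φ (Multiplicative.ofAdd 4) p') = 10 ∨
      redDim (faceCorners cc_night4C10 Φ (Multiplicative.ofAdd 4) p') = 11 ∨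
      redDim (faceCorners cc_night4C10 Φ (Multiplicative.ofAdd 4) p') = 15 := by
  decide +kernel

/-- The five pieces assembled: the value set on all representative pairs. -/
theorem redDim_faceCorners_C10_reps : ∀ Φ ∈ cmTypes cc_night4C10, ∀ p ∈ night4Reps_C10, ∀ p' ∈ night4Reps_C10,
    p' ∉ place cc_night4C10 p →
      redDim (faceCorners cc_night4C10 Φ p p') = 10 ∨ redDim (faceCorners cc_night4C10 Φ p p') = 11 ∨
      redDim (faceCorners cc_night4C10 Φ p p') = 15 := by
  intro Φ hΦ p hp p' hp' hne
  simp only [night4Reps_C10, List.mem_cons, List.not_mem_nil, or_false] at hp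
  rcases hp with rfl | rfl | rfl | rfl | rfl
  · exact redDim_faceCorners_C10_reps0 Φ hΦ p' hp' hne
  · exact redDim_faceCorners_C10_reps1 Φ hΦ p' hp' hne
  · exact redDim_faceCorners_C10_reps2 Φ hΦ p' hp' hne
  · exact redDim_faceCorners_C10_reps3 Φ hΦ p' hp' hne
  · exact redDim_faceCorners_C10_reps4 Φ hΦ p' hp' hne

/-! ## Every face of degree 10 -/

/-- **Every census face of the cyclic decic CM field has `dim B_red = 10`, `11` or `15`** (`A₅ × A₅′`, `A₅ × A₅′ × E`,
`A₅ × A₅′ × A₅″`).  KERNEL. -/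
theorem redDim_faceCorners_C10 (Φ : Finset night4C10) (p p' : night4C10) (hΦ : IsCMType cc_night4C10 Φ)
    (hp : p' ∉ place cc_night4C10 p) :
    redDim (faceCorners cc_night4C10 Φ p p') = 10 ∨ redDim (faceCorners cc_night4C10 Φ p p') = 11 ∨
    redDim (faceCorners cc_night4C10 Φ p p') = 15 :=
  redDim_faceCorners_of_reps cc_night4C10_isComplexConj night4Reps_C10 night4Reps_C10_cover
    (fun n => n = 10 ∨ n = 11 ∨ n = 15) Φ (redDim_faceCorners_C10_reps Φ (mem_cmTypes.2 hΦ)) p p' hp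

/-- **No degree-10 face is smaller than the degree-8 ones**: `10 ≤ dim B_red` — ROUTE.md §3.5 (i)'s smallest open
objects (the sixfolds of degree 8) stay the smallest when degree 10 is added to the table. -/
theorem ten_le_redDim_faceCorners_C10 (Φ : Finset night4C10) (p p' : night4C10) (hΦ : IsCMType cc_night4C10 Φ)
    (hp : p' ∉ place cc_night4C10 p) : 10 ≤ redDim (faceCorners cc_night4C10 Φ p p') := by
  rcases redDim_faceCorners_C10 Φ p p' hΦ hp with h | h | h <;> omega

/-- The value 10 is attained (`A₅ × A₅′`). -/
theorem redDim_faceCorners_C10_ten : ∃ (Φ : Finset night4C10) (p p' : night4C10), IsCMType cc_night4C10 Φ ∧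
    p' ∉ place cc_night4C10 p ∧ redDim (faceCorners cc_night4C10 Φ p p') = 10 :=
  ⟨{Multiplicative.ofAdd 5, Multiplicative.ofAdd 6, Multiplicative.ofAdd 7, Multiplicative.ofAdd 8,
      Multiplicative.ofAdd 9}, Multiplicative.ofAdd 0, Multiplicative.ofAdd 1, by decide, by decide, by decide +kernel⟩

/-- The value 11 is attained (`A₅ × A₅′ × E`). -/
theorem redDim_faceCorners_C10_eleven : ∃ (Φ : Finset night4C10) (p p' : night4C10), IsCMType cc_night4C10 Φ ∧
    p' ∉ place cc_night4C10 p ∧ redDim (faceCorners cc_night4C10 Φ p p') = 11 :=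
  ⟨{Multiplicative.ofAdd 5, Multiplicative.ofAdd 6, Multiplicative.ofAdd 7, Multiplicative.ofAdd 8,
      Multiplicative.ofAdd 9}, Multiplicative.ofAdd 1, Multiplicative.ofAdd 3, by decide, by decide, by decide +kernel⟩

/-- The value 15 is attained (`A₅ × A₅′ × A₅″`). -/
theorem redDim_faceCorners_C10_fifteen : ∃ (Φ : Finset night4C10) (p p' : night4C10), IsCMType cc_night4C10 Φ ∧
    p' ∉ place cc_night4C10 p ∧ redDim (faceCorners cc_night4C10 Φ p p') = 15 :=
  ⟨{Multiplicative.ofAdd 5, Multiplicative.ofAdd 6, Multiplicative.ofAdd 7, Multiplicative.ofAdd 8,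
      Multiplicative.ofAdd 9}, Multiplicative.ofAdd 0, Multiplicative.ofAdd 2, by decide, by decide, by decide +kernel⟩

/-- The corners of degree 10: every CM type is primitive (`simpleDim = 5`, a simple CM fivefold) or one of the two lifts
from the imaginary quadratic subfield (`simpleDim = 1`).  KERNEL. -/
theorem simpleDim_C10 : ∀ Φ : Finset night4C10, IsCMType cc_night4C10 Φ → simpleDim Φ = 1 ∨ simpleDim Φ = 5 := by
  decide +kernel

/-- On the product datum of the census face `(Φ; p, p′)` of `C10`, `TypeDatum.redDim diagFour ∈ {10, 11, 15}`. -/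
theorem Route.redDim_prodDatum_faceCorners_C10 (Φ : Finset night4C10) (p p' : night4C10)
    (hΦ : IsCMType cc_night4C10 Φ) (hp : p' ∉ place cc_night4C10 p) :
    (Route.TypeDatum.prodDatum cc_night4C10_isComplexConj (faceCorners cc_night4C10 Φ p p')
      (isCMType_faceCorners cc_night4C10_isComplexConj hΦ p p')).redDim Route.diagFour = 10 ∨
    (Route.TypeDatum.prodDatum cc_night4C10_isComplexConj (faceCorners cc_night4C10 Φ p p')
      (isCMType_faceCorners cc_night4C10_isComplexConj hΦ p p')).redDim Route.diagFour = 11 ∨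
    (Route.TypeDatum.prodDatum cc_night4C10_isComplexConj (faceCorners cc_night4C10 Φ p p')
      (isCMType_faceCorners cc_night4C10_isComplexConj hΦ p p')).redDim Route.diagFour = 15 := by
  rw [Route.TypeDatum.redDim_prodDatum]
  exact redDim_faceCorners_C10 Φ p p' hΦ hp

end HodgeRepro
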